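import Summits.MatrixMultiplication.OmegaCensus.SmallFormats.MatMul22nGF3CountCertificate
import Summits.MatrixMultiplication.OmegaCensus.SmallFormats.InvertiblePointHalfLawPlus
import HarnessLib

/-!
# ω-census family (a): the count-certificate pipeline with the HALF LAW PLUS ONE (invertible cap one lower for even `n`)

Cell `pub-omega` (unit `pub-omega-tensor`, gen 36), topic `Summits/MatrixMultiplication/OmegaCensus` (sub-folder
`SmallFormats`). Framing (verbatim): lottery ticket; floor = certified bounds/negative ranges. HONEST FRAMING: bookkeeping. Tensor
g35's generic pipeline (`succ_le_tensorRank_22n_gf3_of_count_certificate`, p672111: kernel floor + half-law invertible cap `C` +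
an emptiness certificate for the class-count system ⇒ `r + 1 ≤ R_𝔽₃(⟨2,2,n⟩)`) with the cap hypothesis relaxed from
`4r ≤ 11n + 2C + 1` to `4r ≤ 11n + 2C + 2` under `2r < 7n`, using the half law plus one
(`NearSplit.eleven_mul_add_one_le`, this generation): at a rung with `2r < 7n` no invertible point is saturated (final δ-law), so
`11n + 1 ≤ 2r + 2p`, i.e. at most `⌊(4r − 11n − 1)/2⌋` coefficient matrices of the X-marginal are orthogonal to any invertible
`X₀`. For the `𝔽₃` floor rungs `(n, ⌈36n/11⌉)` this is one lower than the half-law cap exactly when `n` is even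
(`(10,33)`: 10, `(12,40)`: 13, `(14,46)`: 14, `(16,53)`: 17, …). A future rung then needs only the certificate `hno`. Nothing here is
a bound on `ω`, and no certificate is in this file.
-/

namespace Summit.MatrixMultiplication.OmegaCensus.SmallFormats.Enum723

open Finset
open Summit.MatrixMultiplication.OmegaCensus.RankOnePlaneCapGeneral
open Literature.Computability.AlgebraicComplexity Matrix

variable {n : ℕ}

/-- **The half law plus one as a cap on the X-marginal** (`𝔽₃`, any `(n, r)` with `2r < 7n`): at every invertible `X₀`,
`11n + 1 + 2·#{i : m_i ⊥ X₀} ≤ 4r` for the X-marginal `m` of an `r`-product computation of `⟨2,2,n⟩`. -/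
theorem invLineCapHalfPlus_xMarginal {r : ℕ} (h7 : 2 * r < 7 * n) (β : BilinComp (mulBilin (ZMod 3) 2 2 n) (Fin r))
    (X₀ : Matrix (Fin 2) (Fin 2) (ZMod 3)) (hX₀ : X₀.det ≠ 0) :
    11 * n + 1 + 2 * (Finset.univ.filter fun i => dotX (mflat (xMarginal β i)) X₀ = 0).card ≤ 4 * r := by
  have h0 : 2 * n + 1 ≤ (Finset.univ.filter fun i => β.f i X₀ ≠ 0).card :=
    DeltaLaw.two_mul_add_one_le_card_filter_ne_of_lt β (by rw [Fintype.card_fin]; exact h7) X₀ (isUnit_iff_ne_zero.mpr hX₀)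
  have h1 := NearSplit.eleven_mul_add_one_le β X₀ (isUnit_iff_ne_zero.mpr hX₀) h0
  rw [Fintype.card_fin] at h1
  change 11 * n + 1 ≤ 2 * r + 2 * (Finset.univ.filter fun i => ¬ β.f i X₀ = 0).card at h1
  have hsplit := Finset.card_filter_add_card_filter_not (s := (Finset.univ : Finset (Fin r))) (fun i => β.f i X₀ = 0)
  rw [Finset.card_univ, Fintype.card_fin] at hsplit
  have hcongr : (Finset.univ.filter fun i => dotX (mflat (xMarginal β i)) X₀ = 0) =
      Finset.univ.filter fun i => β.f i X₀ = 0 := by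
    refine Finset.filter_congr fun i _ => ?_
    rw [f_apply_eq_dotX]
  rw [hcongr]
  omega

/-- **Census reduction with the half-law-plus-one universe** (`𝔽₃`, floor rung `r ≤ R_𝔽₃(⟨2,2,n⟩)`, `2r < 7n`): IF every
nowhere-zero `m` in `XCaps3 n r` satisfying `11n + 1 + 2·#{i : m_i ⊥ X₀} ≤ 4r` at every invertible `X₀` is `InOrbit`-related to
a member of `Reps`, AND no member of `Reps` is an X-marginal, THEN `r + 1 ≤ R_𝔽₃(⟨2,2,n⟩)`. -/
theorem succ_le_tensorRank_22n_gf3_of_halfPlus_enumeration (r : ℕ) (hr : r ≤ tensorRank (matMulTensor (ZMod 3) 2 2 n))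
    (h7 : 2 * r < 7 * n) (Reps : Set (Fin r → Matrix (Fin 2) (Fin 2) (ZMod 3)))
    (henum : ∀ m : Fin r → Matrix (Fin 2) (Fin 2) (ZMod 3), (∀ i, m i ≠ 0) → XCaps3 n r m →
      (∀ X₀ : Matrix (Fin 2) (Fin 2) (ZMod 3), X₀.det ≠ 0 →
        11 * n + 1 + 2 * (Finset.univ.filter fun i => dotX (mflat (m i)) X₀ = 0).card ≤ 4 * r) →
      ∃ rep ∈ Reps, InOrbit m rep)
    (hexcl : ∀ rep ∈ Reps, ∀ β : BilinComp (mulBilin (ZMod 3) 2 2 n) (Fin r), xMarginal β ≠ rep) :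
    r + 1 ≤ tensorRank (matMulTensor (ZMod 3) 2 2 n) :=
  succ_le_tensorRank_22n_of_orbit_census r Reps
    (fun β => henum _ (xMarginal_ne_zero_of_le_tensorRank hr β) (xCaps3_xMarginal β)
      (fun X₀ hX₀ => invLineCapHalfPlus_xMarginal h7 β X₀ hX₀)) hexcl

/-- **The count-certificate pipeline, plus one.** If `r ≤ R_𝔽₃(⟨2,2,n⟩)` (kernel floor), `2r < 7n`, `4r ≤ 11n + 2C + 2` (so the
half law plus one caps the invertible lines at `C`), and NO count vector satisfies the class-wise clauses with invertible cap `C`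
and total `r`, then `r + 1 ≤ R_𝔽₃(⟨2,2,n⟩)`. -/
theorem succ_le_tensorRank_22n_gf3_of_count_certificate' (n r C : ℕ) (hr : r ≤ tensorRank (matMulTensor (ZMod 3) 2 2 n))
    (h7 : 2 * r < 7 * n) (hC : 4 * r ≤ 11 * n + 2 * C + 2)
    (hno : ∀ c : ℕ → ℕ, (∀ k, k < 32 → load c k + 3 * n ≤ r) → (∀ k, 32 ≤ k → k < 40 → load c k + 6 * n ≤ 2 * r) →
      (∀ k, 40 ≤ k → k < 58 → load c k + 3 * n ≤ r) → (∀ k, 58 ≤ k → k < 82 → load c k ≤ C) → tot c = r → False) :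
    r + 1 ≤ tensorRank (matMulTensor (ZMod 3) 2 2 n) := by
  refine succ_le_tensorRank_22n_gf3_of_halfPlus_enumeration r hr h7 ∅ ?_ (fun rep hrep => absurd hrep (by simp))
  intro m hm hX hhalf
  exfalso
  obtain ⟨hJ, hRC, hQ, hL, ht⟩ := cnt_clauses (C := C) m hm hX fun X₀ hX₀ => by have h := hhalf X₀ hX₀; omega
  exact hno (cnt m) hJ hRC hQ hL ht

/-- **Rung candidate `34 ≤ R_𝔽₃(⟨2,2,10⟩)` reduced to a count certificate at `C = 10`** (floor `⌈360/11⌉ = 33` in kernel;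
`2·33 = 66 < 70`, `4·33 = 132 = 110 + 20 + 2`). The certificate is NOT in this file. -/
theorem thirtyfour_le_tensorRank_2210_gf3_of_count_certificate
    (hno : ∀ c : ℕ → ℕ, (∀ k, k < 32 → load c k + 3 * 10 ≤ 33) → (∀ k, 32 ≤ k → k < 40 → load c k + 6 * 10 ≤ 2 * 33) →
      (∀ k, 40 ≤ k → k < 58 → load c k + 3 * 10 ≤ 33) → (∀ k, 58 ≤ k → k < 82 → load c k ≤ 10) → tot c = 33 → False) :
    34 ≤ tensorRank (matMulTensor (ZMod 3) 2 2 10) :=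
  succ_le_tensorRank_22n_gf3_of_count_certificate' 10 33 10
    (by have h := (tensorRank_matMulTensor_22n_gf3_window 10 (by norm_num)).1; omega) (by norm_num) (by norm_num) hno

/-- **Rung candidate `41 ≤ R_𝔽₃(⟨2,2,12⟩)` reduced to a count certificate at `C = 13`** (floor `⌈432/11⌉ = 40`; `80 < 84`,
`160 = 132 + 26 + 2`). The certificate is NOT in this file. -/
theorem fortyone_le_tensorRank_2212_gf3_of_count_certificate
    (hno : ∀ c : ℕ → ℕ, (∀ k, k < 32 → load c k + 3 * 12 ≤ 40) → (∀ k, 32 ≤ k → k < 40 → load c k + 6 * 12 ≤ 2 * 40) →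
      (∀ k, 40 ≤ k → k < 58 → load c k + 3 * 12 ≤ 40) → (∀ k, 58 ≤ k → k < 82 → load c k ≤ 13) → tot c = 40 → False) :
    41 ≤ tensorRank (matMulTensor (ZMod 3) 2 2 12) :=
  succ_le_tensorRank_22n_gf3_of_count_certificate' 12 40 13
    (by have h := (tensorRank_matMulTensor_22n_gf3_window 12 (by norm_num)).1; omega) (by norm_num) (by norm_num) hno

end Summit.MatrixMultiplication.OmegaCensus.SmallFormats.Enum723
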